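import Mathlib.RingTheory.IntegralClosure.IsIntegralClosure.Basic
import Mathlib.RingTheory.Algebraic.Integral
import Mathlib.RingTheory.AlgebraicIndependent.TranscendenceBasis
import Mathlib.RingTheory.MvPolynomial.Homogeneous
import Mathlib.Algebra.MvPolynomial.Equiv
import Mathlib.Algebra.MvPolynomial.Funext
import Mathlib.Algebra.MvPolynomial.Monad
import Mathlib.RingTheory.Polynomial.Basic
import Mathlib.LinearAlgebra.LinearIndependent.Lemmas
import Mathlib.RingTheory.KrullDimension.Polynomial
import Literature.RingTheory.HilbertSamuel.PolynomialRing
import Literature.RingTheory.KrullDimension.AffineDimension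
import HarnessLib

/-!
# Hilbert function of a filtered affine domain: `ρ·binom(t-a+m, m) ≤ dim_K W^t ≤ ρ·binom(t+γ+m, m)`

Topic: `Literature/RingTheory/HilbertSamuel`. For a domain `R` finitely generated over an INFINITE
field `K` by a finite-dimensional subspace `W ∋ 1`, the Hilbert function `t ↦ dim_K W^t` of the
filtration by powers of `W` grows like a polynomial of degree exactly `m = dim R` (Krull) with a
positive integral normalised leading coefficient:

* `FilteredHilbert.hilbert_sandwich` — there are `ρ ≥ 1`, `a`, `γ ∈ ℕ` with
  `ρ · binom(t - a + m, m) ≤ dim_K W^t ≤ ρ · binom(t + γ + m, m)` for all `t ≥ a`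
  (so `dim_K W^t = ρ t^m/m! + O(t^{m-1})`).

This is the degree theory behind the "`𝓗(I; D)`" of zero estimates on commutative algebraic groups
(Nesterenko–Philippon (eds.), LNM 1752, Ch. 11, §2.2, (85): "`H(I;D) = (c/d!) D^d + …`, …
`𝓗(I; D) = c D^d`") in the form needed for sub-varieties of `𝔾ₐ × 𝔾ₘⁿ` filtered by box degrees:
the Rees-type algebra `K[Wτ] = ⊕_t W^t τ^t ⊆ R[τ]` is the homogeneous coordinate ring, and
`hilbert_sandwich` replaces the Hilbert polynomial (Hilbert–Serre is not in Mathlib at this pin)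
by a two-sided binomial bound, which suffices for Bézout-type inequalities.

## Contents (proved here; classical commutative algebra)

1. Scaling of values of homogeneous polynomials (`aeval_const_mul`, `aeval_C_mul_X`, `aeval_cX`),
   a good dehomogenisation point over an infinite field (`exists_eval_cons_one_ne_zero`),
   evaluation through `finSuccEquiv` (`aeval_fin_cons`).
2. **Linear (graded) Noether normalisation** (Atiyah–Macdonald Ex. 5.16; Eisenbud Lemma 13.2,
   Thm 13.3) for subalgebras of `R[τ]` generated by degree-one elements `vτ`:
   `integral_step` (a homogeneous relation `F(v) = 0` and `λ` with `F(1, λ) ≠ 0` make `v₀τ`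
   integral over `K[vᵢ'τ]`, `vᵢ' = vᵢ - λᵢ v₀`) and `linear_noether` (there are `K`-linear
   combinations `u₁, …, u_r` of the `vⱼ` with `uᵢτ` algebraically independent and all `vⱼτ`
   integral over `K[uτ]`). Mathlib has only Nagata's non-linear normalisation
   (`Mathlib.RingTheory.NoetherNormalization`), which does not respect the grading.
3. The Rees-type algebra `reesAlgebra K W = K[Wτ]` with `mem_reesAlgebra_iff`
   (`p ∈ K[Wτ] ↔ ∀ t, p_t ∈ W^t`), slices `slice t p = C(p_t)τ^t`, graded pieces of `K[uτ]`
   (`slice_aeval_cX`), dependence relations over a ring (`exists_smul_mem_span_of_dep`).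
4. `exists_core`: `P = K[uτ] ⊆ K[Wτ]` finite, a maximal `P`-free family of homogeneous module
   generators `bᵢ = C(βᵢ)τ^{dᵢ}` (`ρ ≥ 1` of them) and a homogeneous common denominator
   `C(κ)τ^γ ∈ P`, `κ ≠ 0`, with `C(κ)τ^γ · K[Wτ] ⊆ ⊕ᵢ P bᵢ`.
5. Counting (`countMap`, `sum_choose_le_finrank_pow`, `finrank_pow_le_sum_choose`): in degree
   `t`, `⊕ᵢ P_{t-dᵢ} bᵢ ↪ W^t τ^t` and `C(κ)τ^γ · W^t τ^t ↪ ⊕ᵢ P_{t+γ-dᵢ} bᵢ`, with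
   `dim P_e = binom(e + r - 1, e)` (`finrank_homogeneousSubmodule_fin`); `exists_sandwich`.
6. `ringKrullDim_add_one_eq`: `uτ` is a transcendence basis of `R[τ]`, so
   `r = dim R[τ] = dim R + 1` (`Literature.RingTheory.KrullDimension.ringKrullDim_eq_card_of_isTranscendenceBasis`,
   `Polynomial.ringKrullDim_of_isNoetherianRing`); whence `hilbert_sandwich`.

Deliberately NOT here: eventual polynomiality of `t ↦ dim W^t` (Hilbert–Serre), multiplicities
of non-reduced ideals, anything about specific varieties.

## References

* M. F. Atiyah, I. G. Macdonald, *Introduction to Commutative Algebra* (1969), Ch. 5 Ex. 16;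
  Ch. 11, Thm 11.1, Cor. 11.2. [AtiyahMacdonald1969]
* D. Eisenbud, *Commutative Algebra with a View Toward Algebraic Geometry*, GTM 150 (1995),
  Lemma 13.2, Thm 13.3. [Eisenbud1995]
* Yu. V. Nesterenko, P. Philippon (eds.), *Introduction to Algebraic Independence Theory*,
  LNM 1752 (2001), Ch. 11 (D. Roy), §2.2 (85). [NesterenkoPhilippon2001]
* H. Matsumura, *Commutative Ring Theory* (1986), Thm 5.6. [Matsumura1987]
-/

noncomputable section

open MvPolynomial
open scoped Polynomial

namespace Literature.RingTheory.HilbertSamuel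

namespace FilteredHilbert

/-! ### Homogeneous polynomials: scaling of evaluations -/

section Homogeneous

variable {K : Type*} [Field K] {σ : Type*}

/-- For `F` homogeneous of degree `δ`: `F(c v) = c^δ F(v)` in any commutative `K`-algebra.
[folklore] -/
theorem aeval_const_mul {S : Type*} [CommRing S] [Algebra K S] {F : MvPolynomial σ K} {δ : ℕ}
    (hF : F.IsHomogeneous δ) (c : S) (v : σ → S) :
    aeval (fun i => c * v i) F = c ^ δ * aeval v F := by
  classical
  simp only [MvPolynomial.aeval_def, MvPolynomial.eval₂_eq]
  rw [Finset.mul_sum]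
  refine Finset.sum_congr rfl fun d hd => ?_
  have hdeg : ∑ i ∈ d.support, d i = δ := by
    have h := hF (mem_support_iff.mp hd)
    simpa [Finsupp.weight_apply, Finsupp.sum] using h
  have hprod : ∏ i ∈ d.support, (c * v i) ^ d i =
      c ^ δ * ∏ i ∈ d.support, v i ^ d i := by
    rw [← hdeg, ← Finset.prod_pow_eq_pow_sum, ← Finset.prod_mul_distrib]
    exact Finset.prod_congr rfl fun i _ => mul_pow c (v i) (d i)
  rw [hprod]
  ring

/-- For `F` homogeneous of degree `δ` and `v : σ → R`: in `R[X]`,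
`F(v₁X, …, v_σX) = X^δ · C(F(v))`. [folklore] -/
theorem aeval_C_mul_X {R : Type*} [CommRing R] [Algebra K R] {F : MvPolynomial σ K} {δ : ℕ}
    (hF : F.IsHomogeneous δ) (v : σ → R) :
    aeval (fun i => (Polynomial.X : R[X]) * Polynomial.C (v i)) F =
      Polynomial.X ^ δ * Polynomial.C (aeval v F) := by
  rw [aeval_const_mul hF]
  congr 1
  have h := MvPolynomial.comp_aeval (R := K) (f := v) (IsScalarTower.toAlgHom K R R[X])
  have h' : (fun i => (IsScalarTower.toAlgHom K R R[X]) (v i)) = fun i => Polynomial.C (v i) := by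
    funext i; rfl
  rw [h'] at h
  rw [← h]
  rfl

/-- A non-zero homogeneous polynomial over an infinite field has a non-zero value at a point
whose first coordinate is `1`. [folklore] -/
theorem exists_eval_cons_one_ne_zero [Infinite K] {g : ℕ} {F : MvPolynomial (Fin (g + 1)) K}
    {δ : ℕ} (hF : F.IsHomogeneous δ) (hF0 : F ≠ 0) :
    ∃ lam : Fin g → K, MvPolynomial.eval (Fin.cons 1 lam : Fin (g + 1) → K) F ≠ 0 := by
  -- a point where `X₀ · F` does not vanish
  have hXF : (X 0 * F : MvPolynomial (Fin (g + 1)) K) ≠ 0 := mul_ne_zero (X_ne_zero 0) hF0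
  obtain ⟨r, hr⟩ : ∃ r : Fin (g + 1) → K, MvPolynomial.eval r (X 0 * F) ≠ 0 := by
    by_contra! h
    exact hXF (MvPolynomial.funext fun r => by rw [h r, map_zero])
  rw [map_mul, MvPolynomial.eval_X] at hr
  have hr0 : r 0 ≠ 0 := left_ne_zero_of_mul hr
  have hrF : MvPolynomial.eval r F ≠ 0 := right_ne_zero_of_mul hr
  refine ⟨fun i => (r 0)⁻¹ * r i.succ, ?_⟩
  have hcons : (Fin.cons 1 (fun i => (r 0)⁻¹ * r i.succ) : Fin (g + 1) → K) =
      fun i => (r 0)⁻¹ * r i := by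
    funext i
    refine Fin.cases ?_ (fun j => ?_) i
    · simp [hr0]
    · simp
  rw [hcons]
  have h := aeval_const_mul (S := K) hF (r 0)⁻¹ r
  have h' : MvPolynomial.eval (fun i => (r 0)⁻¹ * r i) F = ((r 0)⁻¹) ^ δ * MvPolynomial.eval r F := by
    simpa only [MvPolynomial.aeval_eq_eval] using h
  rw [h']
  exact mul_ne_zero (pow_ne_zero _ (inv_ne_zero hr0)) hrF

/-- Evaluation at `Fin.cons y s` through `finSuccEquiv`: `F(y, s) = ∑ⱼ Fⱼ(s) yʲ` where
`Fⱼ` are the coefficients of `F` viewed as a polynomial in `X₀`. [folklore] -/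
theorem aeval_fin_cons {S : Type*} [CommRing S] [Algebra K S] {g : ℕ}
    (F : MvPolynomial (Fin (g + 1)) K) (y : S) (s : Fin g → S) :
    aeval (Fin.cons y s : Fin (g + 1) → S) F =
      Polynomial.aevalTower (aeval s : MvPolynomial (Fin g) K →ₐ[K] S) y (finSuccEquiv K g F) := by
  -- both sides are `K`-algebra maps agreeing on the variables
  have hR : ∀ G, Polynomial.aevalTower (aeval s : MvPolynomial (Fin g) K →ₐ[K] S) y
      (finSuccEquiv K g G) = ((Polynomial.aevalTower (aeval s : MvPolynomial (Fin g) K →ₐ[K] S)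
        y).comp (finSuccEquiv K g).toAlgHom) G := fun G => rfl
  rw [hR]
  refine AlgHom.congr_fun (MvPolynomial.algHom_ext fun i => ?_) F
  refine Fin.cases ?_ (fun j => ?_) i
  · simp [finSuccEquiv_X_zero]
  · simp [finSuccEquiv_X_succ]

/-- The same, as a finite sum `F(y, s) = ∑ⱼ Fⱼ(s) yʲ`. [folklore] -/
theorem aeval_fin_cons_eq_sum {S : Type*} [CommRing S] [Algebra K S] {g : ℕ}
    (F : MvPolynomial (Fin (g + 1)) K) (y : S) (s : Fin g → S) {N : ℕ}
    (hN : (finSuccEquiv K g F).natDegree < N) :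
    aeval (Fin.cons y s : Fin (g + 1) → S) F =
      ∑ j ∈ Finset.range N, aeval s ((finSuccEquiv K g F).coeff j) * y ^ j := by
  rw [aeval_fin_cons]
  exact Polynomial.eval₂_eq_sum_range' _ hN y

end Homogeneous

end FilteredHilbert

end Literature.RingTheory.HilbertSamuel

namespace Literature.RingTheory.HilbertSamuel.FilteredHilbert

open MvPolynomial
open scoped Polynomial

variable {K : Type*} [Field K] {R : Type*} [CommRing R] [Algebra K R]

/-- The degree-one element `w·τ` of `R[τ]` attached to `w ∈ R` (the generators of the Rees-type
algebra of a filtration). [folklore] -/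
def cX (w : R) : R[X] := Polynomial.C w * Polynomial.X

omit [Algebra K R] in
/-- Unfolding `cX`. [folklore] -/
@[simp] theorem cX_def (w : R) : cX w = Polynomial.C w * Polynomial.X := rfl

omit [Algebra K R] in
/-- `cX` is additive. [folklore] -/
theorem cX_add (a b : R) : cX (a + b) = cX a + cX b := by
  simp [cX, add_mul]

/-- `cX` is `K`-linear. [folklore] -/
theorem cX_smul (k : K) (a : R) : cX (k • a) = k • cX a := by
  simp [cX, Algebra.smul_def, mul_assoc]

omit [Algebra K R] in
/-- Powers of `wτ`: `(wτ)^j = C(w^j) τ^j`. [folklore] -/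
theorem cX_pow (a : R) (j : ℕ) : cX a ^ j = Polynomial.C (a ^ j) * Polynomial.X ^ j := by
  simp [cX, mul_pow]

/-- `F(v₁τ, …) = C(F(v)) τ^δ` for `F` homogeneous of degree `δ`. [folklore] -/
theorem aeval_cX {σ : Type*} {F : MvPolynomial σ K} {δ : ℕ} (hF : F.IsHomogeneous δ)
    (v : σ → R) :
    aeval (fun i => cX (v i)) F = Polynomial.C (aeval v F) * Polynomial.X ^ δ := by
  have h := aeval_C_mul_X hF v
  have e : (fun i => cX (v i)) = fun i => (Polynomial.X : R[X]) * Polynomial.C (v i) := by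
    funext i; exact mul_comm _ _
  rw [e, h, mul_comm]

/-- **The integrality step of the linear Noether normalisation.** If the degree-one elements
`v₀τ, …, v_gτ` of `R[τ]` satisfy a non-trivial homogeneous relation `F(v) = 0`, then after the
linear change `vᵢ' = vᵢ - λᵢ v₀` (`λ` with `F(1, λ) ≠ 0`, which exists over an infinite field)
the element `v₀τ` is integral over `K[v₁'τ, …, v_g'τ]`. [folklore; cf. Atiyah–Macdonald,
*Introduction to Commutative Algebra*, Ex. 5.16] [folklore] -/
theorem integral_step [Infinite K] {g : ℕ} (v : Fin (g + 1) → R)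
    {F : MvPolynomial (Fin (g + 1)) K} {δ : ℕ} (hF : F.IsHomogeneous δ) (hF0 : F ≠ 0)
    (hv : aeval v F = 0) :
    ∃ lam : Fin g → K, IsIntegral
      (Algebra.adjoin K (Set.range fun i : Fin g => cX (v i.succ - lam i • v 0)))
      (cX (v 0)) := by
  classical
  obtain ⟨lam, hc⟩ := exists_eval_cons_one_ne_zero hF hF0
  refine ⟨lam, ?_⟩
  set c : K := MvPolynomial.eval (Fin.cons 1 lam : Fin (g + 1) → K) F with hc_def
  set v' : Fin g → R := fun i => v i.succ - lam i • v 0 with hv'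
  -- the linearly substituted polynomial `G(Y₀, Y') = F(Y₀, Y' + λ Y₀)`
  set f : Fin (g + 1) → MvPolynomial (Fin (g + 1)) K :=
    Fin.cons (X 0) (fun i => X i.succ + C (lam i) * X 0) with hf
  set G : MvPolynomial (Fin (g + 1)) K := bind₁ f F with hG_def
  have hfhom : ∀ i, (f i).IsHomogeneous 1 := by
    intro i
    refine Fin.cases ?_ (fun j => ?_) i
    · simpa [f] using isHomogeneous_X K (0 : Fin (g + 1))
    · simpa [f] using (isHomogeneous_X K j.succ).add (isHomogeneous_C_mul_X (lam j) 0)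
  have hG : G.IsHomogeneous δ := by
    have h := hF.aeval f hfhom
    rwa [one_mul, aeval_eq_bind₁] at h
  -- `G(v₀, v') = F(v) = 0`
  have hGv : aeval (Fin.cons (v 0) v' : Fin (g + 1) → R) G = 0 := by
    rw [hG_def, aeval_bind₁]
    have e : (fun i => aeval (Fin.cons (v 0) v' : Fin (g + 1) → R) (f i)) = v := by
      funext i
      refine Fin.cases ?_ (fun j => ?_) i
      · simp [f]
      · simp [f, v', Algebra.smul_def, mul_comm]
    rw [e, hv]
  -- `G(1, 0) = F(1, λ) = c`
  have hG1 : MvPolynomial.eval (Fin.cons 1 0 : Fin (g + 1) → K) G = c := by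
    have h := aeval_bind₁ (Fin.cons 1 0 : Fin (g + 1) → K) f F
    have h' : MvPolynomial.eval (Fin.cons 1 0 : Fin (g + 1) → K) G =
        MvPolynomial.eval (fun i => MvPolynomial.eval (Fin.cons 1 0 : Fin (g + 1) → K) (f i)) F := by
      simpa only [MvPolynomial.aeval_eq_eval, hG_def] using h
    rw [h', hc_def]
    have e : (fun i => MvPolynomial.eval (Fin.cons 1 0 : Fin (g + 1) → K) (f i)) =
        (Fin.cons 1 lam : Fin (g + 1) → K) := by
      funext i
      refine Fin.cases ?_ (fun j => ?_) i
      · simp [f]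
      · simp [f]
    rw [e]
  -- the coefficients of `G` as a polynomial in `Y₀`
  set Q : Polynomial (MvPolynomial (Fin g) K) := finSuccEquiv K g G with hQ_def
  have hQdeg : Q.natDegree ≤ δ := by
    rw [hQ_def, natDegree_finSuccEquiv]
    exact (degreeOf_le_totalDegree G 0).trans hG.totalDegree_le
  have hQhom : ∀ j, j ≤ δ → (Q.coeff j).IsHomogeneous (δ - j) := fun j hj =>
    hG.finSuccEquiv_coeff_isHomogeneous j (δ - j) (by omega)
  have hQconst : ∀ j, j < δ → (Q.coeff j).coeff 0 = 0 := by
    intro j hj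
    exact (hQhom j hj.le).coeff_eq_zero (d := 0) (by simp; omega)
  have heval0 : ∀ p : MvPolynomial (Fin g) K, MvPolynomial.eval (0 : Fin g → K) p = p.coeff 0 :=
    fun p => eval₂Hom_zero_apply _ _
  have hQδ : Q.coeff δ = C c := by
    have h0 : (Q.coeff δ).IsHomogeneous 0 := by simpa using hQhom δ le_rfl
    have h1 : Q.coeff δ = C ((Q.coeff δ).coeff 0) := by
      rw [← totalDegree_eq_zero_iff_eq_C]
      exact Nat.eq_zero_of_le_zero h0.totalDegree_le
    -- evaluate `G` at `(1, 0, …, 0)`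
    have h2 : MvPolynomial.eval (Fin.cons 1 0 : Fin (g + 1) → K) G =
        ∑ j ∈ Finset.range (δ + 1), MvPolynomial.eval (0 : Fin g → K) (Q.coeff j) * 1 ^ j := by
      have h := aeval_fin_cons_eq_sum (S := K) G 1 (0 : Fin g → K) (N := δ + 1)
        (by rw [← hQ_def]; omega)
      simpa only [MvPolynomial.aeval_eq_eval] using h
    have h3 : ∑ j ∈ Finset.range (δ + 1), MvPolynomial.eval (0 : Fin g → K) (Q.coeff j) * 1 ^ j
        = (Q.coeff δ).coeff 0 := by
      rw [Finset.sum_range_succ, Finset.sum_eq_zero (fun j hj => ?_)]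
      · simp only [one_pow, mul_one, zero_add, heval0]
      · rw [Finset.mem_range] at hj
        rw [heval0, hQconst j hj, zero_mul]
    rw [h1, ← h3, ← h2, hG1]
  have hc0 : c ≠ 0 := hc
  have hQnat : Q.natDegree = δ := by
    refine le_antisymm hQdeg (Polynomial.le_natDegree_of_ne_zero ?_)
    rw [hQδ]
    exact (map_ne_zero_iff _ (C_injective _ _)).mpr hc0
  have hQlead : Q.leadingCoeff = C c := by
    rw [Polynomial.leadingCoeff, hQnat, hQδ]
  -- the monic polynomial `c⁻¹ Q`
  set q : Polynomial (MvPolynomial (Fin g) K) := Polynomial.C (C c⁻¹) * Q with hq_def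
  have hq : q.Monic := by
    refine Polynomial.monic_C_mul_of_mul_leadingCoeff_eq_one ?_
    rw [hQlead, ← C_mul, inv_mul_cancel₀ hc0, C_1]
  -- `v₀τ` is a root of `Q` (hence of `q`) under `Y' ↦ v'τ`
  set ψ : MvPolynomial (Fin g) K →ₐ[K] R[X] := aeval fun i => cX (v' i) with hψ
  have hroot : Polynomial.eval₂ (ψ : MvPolynomial (Fin g) K →+* R[X]) (cX (v 0)) Q = 0 := by
    rw [Polynomial.eval₂_eq_sum_range' (ψ : MvPolynomial (Fin g) K →+* R[X])
      (show Q.natDegree < δ + 1 by omega)]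
    have hterm : ∀ j ∈ Finset.range (δ + 1),
        (ψ : MvPolynomial (Fin g) K →+* R[X]) (Q.coeff j) * cX (v 0) ^ j =
          Polynomial.C (aeval v' (Q.coeff j) * v 0 ^ j) * Polynomial.X ^ δ := by
      intro j hj
      rw [Finset.mem_range] at hj
      have h1 : (ψ : MvPolynomial (Fin g) K →+* R[X]) (Q.coeff j) =
          Polynomial.C (aeval v' (Q.coeff j)) * Polynomial.X ^ (δ - j) := aeval_cX (hQhom j (by omega)) v'
      rw [h1, cX_pow, map_mul]
      have e : δ - j + j = δ := by omega
      calc Polynomial.C ((aeval v') (Q.coeff j)) * Polynomial.X ^ (δ - j) *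
            (Polynomial.C (v 0 ^ j) * Polynomial.X ^ j)
          = Polynomial.C ((aeval v') (Q.coeff j)) * Polynomial.C (v 0 ^ j) *
              (Polynomial.X ^ (δ - j) * Polynomial.X ^ j) := by ring
        _ = _ := by rw [← pow_add, e]
    rw [Finset.sum_congr rfl hterm, ← Finset.sum_mul, ← map_sum,
      ← aeval_fin_cons_eq_sum G (v 0) v' (N := δ + 1) (by rw [← hQ_def]; omega), hGv,
      map_zero, zero_mul]
  have hrootq : Polynomial.eval₂ (ψ : MvPolynomial (Fin g) K →+* R[X]) (cX (v 0)) q = 0 := by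
    rw [hq_def, Polynomial.eval₂_mul, hroot, mul_zero]
  -- integrality over the image of `ψ`, which is `K[v'τ]`
  have hint : IsIntegral ψ.range (cX (v 0)) := by
    refine ⟨q.map ψ.rangeRestrict.toRingHom, hq.map _, ?_⟩
    have hcomp : (algebraMap ψ.range R[X]).comp ψ.rangeRestrict.toRingHom =
        (ψ : MvPolynomial (Fin g) K →+* R[X]) := RingHom.ext fun _ => rfl
    rw [Polynomial.eval₂_map, hcomp]
    exact hrootq
  have hrange : Algebra.adjoin K (Set.range fun i : Fin g => cX (v i.succ - lam i • v 0)) =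
      ψ.range := by
    rw [hψ, ← Algebra.adjoin_range_eq_range_aeval]
  rw [hrange]
  exact hint

/-- Integrality over a subalgebra is inherited by larger subalgebras. [folklore] -/
theorem isIntegral_of_le {L : Type*} [CommRing L] [Algebra K L] {S T : Subalgebra K L}
    (h : S ≤ T) {x : L} (hx : IsIntegral S x) : IsIntegral T x := by
  obtain ⟨p, hp, hpx⟩ := hx
  refine ⟨p.map (Subalgebra.inclusion h).toRingHom, hp.map _, ?_⟩
  have hcomp : (algebraMap T L).comp (Subalgebra.inclusion h).toRingHom = algebraMap S L :=
    RingHom.ext fun _ => rfl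
  rw [Polynomial.eval₂_map, hcomp]
  exact hpx

/-- If `x` is integral over a `K`-subalgebra `S` all of whose elements are integral over the
`K`-subalgebra `A`, then `x` is integral over `A`. [folklore] -/
theorem isIntegral_of_isIntegral_subalgebra {L : Type*} [CommRing L] [Algebra K L]
    {A S : Subalgebra K L} (hS : ∀ s ∈ S, IsIntegral A s) {x : L} (hx : IsIntegral S x) :
    IsIntegral A x := by
  set IC := integralClosure A L with hIC
  have hle : S ≤ IC.restrictScalars K := fun s hs => hS s hs
  -- transport the monic polynomial along `S → IC`
  obtain ⟨p, hp, hpx⟩ := hx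
  let φ : S →+* IC :=
    { toFun := fun s => ⟨s, hle s.2⟩
      map_one' := rfl
      map_mul' := fun _ _ => rfl
      map_zero' := rfl
      map_add' := fun _ _ => rfl }
  have hIC' : IsIntegral IC x := by
    refine ⟨p.map φ, hp.map _, ?_⟩
    have hcomp : (algebraMap IC L).comp φ = algebraMap S L := RingHom.ext fun _ => rfl
    rw [Polynomial.eval₂_map, hcomp]
    exact hpx
  exact isIntegral_trans x hIC'

/-- **Linear (graded) Noether normalisation** for the Rees-type algebra generated by degree-one
elements `v₁τ, …, v_gτ` of `R[τ]` over an infinite field `K`: there are `K`-linear combinations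
`u₁, …, u_r` of the `vⱼ` such that `u₁τ, …, u_rτ` are algebraically independent over `K` and
every `vⱼτ` is integral over `K[u₁τ, …, u_rτ]`. [folklore; cf. Atiyah–Macdonald, Ex. 5.16;
Eisenbud, *Commutative Algebra*, Thm 13.3] [folklore] -/
theorem linear_noether [Infinite K] [IsDomain R] :
    ∀ (g : ℕ) (v : Fin g → R), ∃ (r : ℕ) (u : Fin r → R),
      (∀ i, u i ∈ Submodule.span K (Set.range v)) ∧
      AlgebraicIndependent K (fun i => cX (u i)) ∧
      ∀ j, IsIntegral (Algebra.adjoin K (Set.range fun i => cX (u i))) (cX (v j)) := by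
  classical
  intro g
  induction g with
  | zero =>
    intro v
    refine ⟨0, fun i => i.elim0, fun i => i.elim0, ?_, fun j => j.elim0⟩
    exact algebraicIndependent_empty_type_iff.mpr (algebraMap K R[X]).injective
  | succ g IH =>
    intro v
    by_cases hind : AlgebraicIndependent K (fun i => cX (v i))
    · refine ⟨g + 1, v, fun i => Submodule.subset_span ⟨i, rfl⟩, hind, fun j => ?_⟩
      exact isIntegral_algebraMap (R := Algebra.adjoin K (Set.range fun i => cX (v i)))
        (x := (⟨cX (v j), Algebra.subset_adjoin ⟨j, rfl⟩⟩ :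
          Algebra.adjoin K (Set.range fun i => cX (v i))))
    · -- a non-trivial relation, and a non-zero homogeneous component of it
      rw [algebraicIndependent_iff_injective_aeval, injective_iff_map_eq_zero] at hind
      push Not at hind
      obtain ⟨F0, hF0v, hF00⟩ := hind
      obtain ⟨δ, hδ⟩ : ∃ δ, homogeneousComponent δ F0 ≠ 0 := by
        by_contra! h
        apply hF00
        rw [← sum_homogeneousComponent F0]
        exact Finset.sum_eq_zero fun δ _ => h δ
      set F := homogeneousComponent δ F0 with hF_def
      have hF : F.IsHomogeneous δ := homogeneousComponent_isHomogeneous δ F0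
      -- `F(v) = 0` in `R`: it is the `τ^δ`-coefficient of `F0(vτ) = 0`
      have hFv : aeval v F = 0 := by
        have hsum : aeval (fun i => cX (v i)) F0 =
            ∑ e ∈ Finset.range (F0.totalDegree + 1),
              Polynomial.C (aeval v (homogeneousComponent e F0)) * Polynomial.X ^ e := by
          conv_lhs => rw [← sum_homogeneousComponent F0]
          rw [map_sum]
          exact Finset.sum_congr rfl fun e _ => aeval_cX (homogeneousComponent_isHomogeneous e F0) v
        have hcoeff := congr_arg (fun P : R[X] => P.coeff δ) hsum
        simp only [hF0v, Polynomial.coeff_zero, Polynomial.finsetSum_coeff,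
          Polynomial.coeff_C_mul_X_pow] at hcoeff
        rw [Finset.sum_ite_eq] at hcoeff
        by_cases hδdeg : δ ∈ Finset.range (F0.totalDegree + 1)
        · rw [if_pos hδdeg] at hcoeff
          exact hcoeff.symm
        · exfalso
          apply hδ
          rw [Finset.mem_range, not_lt] at hδdeg
          exact homogeneousComponent_eq_zero _ _ (by omega)
      obtain ⟨lam, hint0⟩ := integral_step v hF hδ hFv
      set v' : Fin g → R := fun i => v i.succ - lam i • v 0 with hv'
      obtain ⟨r, u, hu, hindu, hintu⟩ := IH v'
      have hspan : Submodule.span K (Set.range v') ≤ Submodule.span K (Set.range v) := by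
        refine Submodule.span_le.mpr ?_
        rintro _ ⟨i, rfl⟩
        exact Submodule.sub_mem _ (Submodule.subset_span ⟨i.succ, rfl⟩)
          (Submodule.smul_mem _ _ (Submodule.subset_span ⟨0, rfl⟩))
      refine ⟨r, u, fun i => hspan (hu i), hindu, ?_⟩
      set A := Algebra.adjoin K (Set.range fun i => cX (u i)) with hA
      -- every element of `K[v'τ]` is integral over `A`
      have hS : ∀ s ∈ Algebra.adjoin K (Set.range fun i : Fin g => cX (v i.succ - lam i • v 0)),
          IsIntegral A s := by
        intro s hs
        have hle : Algebra.adjoin K (Set.range fun i : Fin g => cX (v i.succ - lam i • v 0)) ≤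
            (integralClosure A R[X]).restrictScalars K := by
          refine Algebra.adjoin_le ?_
          rintro _ ⟨i, rfl⟩
          exact hintu i
        exact hle hs
      have h0 : IsIntegral A (cX (v 0)) := isIntegral_of_isIntegral_subalgebra hS hint0
      intro j
      refine Fin.cases ?_ (fun i => ?_) j
      · exact h0
      · have e : cX (v i.succ) = cX (v' i) + lam i • cX (v 0) := by
          rw [← cX_smul, ← cX_add, sub_add_cancel]
        rw [e]
        exact (hintu i).add ((h0.smul (lam i)))


/-! ### The Rees-type algebra of a subspace and its graded pieces -/

variable (K) in
/-- The Rees-type algebra `K[Wτ] ⊆ R[τ]` of a `K`-subspace `W ⊆ R`: the `K`-subalgebra generated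
by the degree-one elements `wτ`, `w ∈ W`. Its degree-`t` piece is `W^t τ^t`
(`mem_reesAlgebra_iff`). [folklore] -/
def reesAlgebra (W : Submodule K R) : Subalgebra K R[X] := Algebra.adjoin K (cX '' (W : Set R))

/-- Membership in the Rees-type algebra is read off coefficientwise: `p ∈ K[Wτ]` iff the
`τ^t`-coefficient of `p` lies in `W^t` for every `t`. [folklore] -/
theorem mem_reesAlgebra_iff {W : Submodule K R} {p : R[X]} :
    p ∈ reesAlgebra K W ↔ ∀ t, p.coeff t ∈ W ^ t := by
  classical
  constructor
  · intro hp
    induction hp using Algebra.adjoin_induction with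
    | mem x hx =>
      obtain ⟨w, hw, rfl⟩ := hx
      intro t
      simp only [cX, Polynomial.coeff_C_mul_X]
      split_ifs with ht
      · subst ht; simpa using hw
      · exact Submodule.zero_mem _
    | algebraMap k =>
      intro t
      rw [Polynomial.algebraMap_apply, Polynomial.coeff_C]
      split_ifs with ht
      · subst ht
        rw [pow_zero]
        exact Submodule.mem_one.mpr ⟨k, rfl⟩
      · exact Submodule.zero_mem _
    | add x y _ _ hx hy => intro t; rw [Polynomial.coeff_add]; exact Submodule.add_mem _ (hx t) (hy t)
    | mul x y _ _ hx hy =>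
      intro t
      rw [Polynomial.coeff_mul]
      refine Submodule.sum_mem _ fun ij hij => ?_
      rw [Finset.mem_antidiagonal] at hij
      rw [← hij, pow_add]
      exact Submodule.mul_mem_mul (hx ij.1) (hy ij.2)
  · intro hp
    rw [← Polynomial.sum_monomial_eq p, Polynomial.sum_def]
    refine Subalgebra.sum_mem _ fun t _ => ?_
    rw [← Polynomial.C_mul_X_pow_eq_monomial]
    -- `C c * X^t ∈ K[Wτ]` for `c ∈ W^t`, by induction on the power
    have key : ∀ (n : ℕ) (c : R), c ∈ W ^ n → Polynomial.C c * Polynomial.X ^ n ∈ reesAlgebra K W := by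
      intro n c hc
      induction hc using Submodule.pow_induction_on_left' with
      | algebraMap k =>
        rw [pow_zero, mul_one, ← Polynomial.algebraMap_apply]
        exact Subalgebra.algebraMap_mem _ k
      | add x y i _ _ hx hy => rw [map_add, add_mul]; exact Subalgebra.add_mem _ hx hy
      | mem_mul m hm i x _ hx =>
        have e : Polynomial.C (m * x) * Polynomial.X ^ i.succ =
            cX m * (Polynomial.C x * Polynomial.X ^ i) := by
          simp only [cX, map_mul, pow_succ]; ring
        rw [e]
        exact Subalgebra.mul_mem _ (Algebra.subset_adjoin ⟨m, hm, rfl⟩) hx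
    exact key t _ (hp t)

/-- The degree-`t` slice `C(p_t) τ^t` of `p ∈ R[τ]`. [folklore] -/
def slice (t : ℕ) (p : R[X]) : R[X] := Polynomial.C (p.coeff t) * Polynomial.X ^ t

omit [Algebra K R] in
/-- Coefficients of a slice. [folklore] -/
@[simp] theorem coeff_slice (t s : ℕ) (p : R[X]) :
    (slice t p).coeff s = if s = t then p.coeff t else 0 := by
  simp [slice]

omit [Algebra K R] in
/-- Slicing is additive. [folklore] -/
theorem slice_add (t : ℕ) (p q : R[X]) : slice t (p + q) = slice t p + slice t q := by
  simp [slice, add_mul]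

omit [Algebra K R] in
/-- Slicing commutes with finite sums. [folklore] -/
theorem slice_sum {ι : Type*} (t : ℕ) (s : Finset ι) (p : ι → R[X]) :
    slice t (∑ i ∈ s, p i) = ∑ i ∈ s, slice t (p i) := by
  simp [slice, Polynomial.finsetSum_coeff, Finset.sum_mul]

omit [Algebra K R] in
/-- A monomial `C b τ^d` is its own slice in degree `d`, and has no other slices. [folklore] -/
theorem slice_C_mul_X_pow (t d : ℕ) (b : R) :
    slice t (Polynomial.C b * Polynomial.X ^ d) = if t = d then Polynomial.C b * Polynomial.X ^ d else 0 := by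
  unfold slice
  rw [Polynomial.coeff_C_mul_X_pow]
  split_ifs with h
  · rw [h]
  · rw [map_zero, zero_mul]

omit [Algebra K R] in
/-- Slices of `a · (C b τ^d)`: `(a · C b τ^d)_{s + d} = a_s · C b τ^d`. [folklore] -/
theorem slice_mul_C_mul_X_pow (a : R[X]) (b : R) (s d : ℕ) :
    slice (s + d) (a * (Polynomial.C b * Polynomial.X ^ d)) =
      slice s a * (Polynomial.C b * Polynomial.X ^ d) := by
  simp only [slice]
  rw [← mul_assoc, Polynomial.coeff_mul_X_pow, Polynomial.coeff_mul_C, map_mul]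
  ring

omit [Algebra K R] in
/-- A polynomial is the sum of its slices. [folklore] -/
theorem sum_slice_eq (p : R[X]) {N : ℕ} (hN : p.natDegree < N) :
    ∑ t ∈ Finset.range N, slice t p = p := by
  conv_rhs => rw [p.as_sum_range' N hN]
  refine Finset.sum_congr rfl fun t _ => ?_
  rw [slice, Polynomial.C_mul_X_pow_eq_monomial]

/-- Slices of elements of the Rees-type algebra stay in it (it is a graded subalgebra). [folklore] -/
theorem slice_mem_reesAlgebra {W : Submodule K R} {p : R[X]} (hp : p ∈ reesAlgebra K W) (t : ℕ) :
    slice t p ∈ reesAlgebra K W := by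
  rw [mem_reesAlgebra_iff] at hp ⊢
  intro s
  rw [coeff_slice]
  split_ifs with h
  · subst h; exact hp _
  · exact Submodule.zero_mem _

/-- The Rees-type algebra of the span of a family is generated by the family. [folklore] -/
theorem adjoin_range_cX_eq {ι : Type*} (w : ι → R) :
    Algebra.adjoin K (Set.range fun i => cX (w i)) = reesAlgebra K (Submodule.span K (Set.range w)) := by
  apply le_antisymm
  · refine Algebra.adjoin_le ?_
    rintro _ ⟨i, rfl⟩
    exact Algebra.subset_adjoin ⟨w i, Submodule.subset_span ⟨i, rfl⟩, rfl⟩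
  · refine Algebra.adjoin_le ?_
    rintro _ ⟨x, hx, rfl⟩
    -- `cX` is `K`-linear, so `cX x` is a `K`-combination of the `cX (w i)`
    let L : R →ₗ[K] R[X] :=
      { toFun := cX
        map_add' := cX_add
        map_smul' := fun k a => cX_smul k a }
    have hx' : L x ∈ Submodule.span K (L '' Set.range w) :=
      Submodule.apply_mem_span_image_of_mem_span L hx
    have hle : Submodule.span K (L '' Set.range w) ≤
        Subalgebra.toSubmodule (Algebra.adjoin K (Set.range fun i => cX (w i))) := by
      refine Submodule.span_le.mpr ?_
      rintro _ ⟨_, ⟨i, rfl⟩, rfl⟩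
      exact Algebra.subset_adjoin ⟨i, rfl⟩
    exact hle hx'

/-- **Graded pieces of `K[uτ]`.** For `u : Fin r → R` and `g` a polynomial in `r` variables, the
degree-`e` slice of `g(uτ)` is `g_e(uτ)` for the homogeneous component `g_e` of `g`. [folklore] -/
theorem slice_aeval_cX {r : ℕ} (u : Fin r → R) (g : MvPolynomial (Fin r) K) (e : ℕ) :
    slice e (aeval (fun i => cX (u i)) g) = aeval (fun i => cX (u i)) (homogeneousComponent e g) := by
  classical
  have hsum : aeval (fun i => cX (u i)) g =
      ∑ d ∈ Finset.range (g.totalDegree + 1),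
        Polynomial.C (aeval u (homogeneousComponent d g)) * Polynomial.X ^ d := by
    conv_lhs => rw [← sum_homogeneousComponent g]
    rw [map_sum]
    exact Finset.sum_congr rfl fun d _ => aeval_cX (homogeneousComponent_isHomogeneous d g) u
  rw [hsum, slice_sum, aeval_cX (homogeneousComponent_isHomogeneous e g) u]
  simp only [slice_C_mul_X_pow]
  rw [Finset.sum_ite_eq]
  split_ifs with h
  · rfl
  · rw [Finset.mem_range, not_lt] at h
    rw [homogeneousComponent_eq_zero _ _ (by omega), map_zero, map_zero, zero_mul]

omit [Algebra K R] in
/-- Slices of `a · (C b τ^d)` in all degrees. [folklore] -/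
theorem slice_mul_C_mul_X_pow' (a : R[X]) (b : R) (t d : ℕ) :
    slice t (a * (Polynomial.C b * Polynomial.X ^ d)) =
      if d ≤ t then slice (t - d) a * (Polynomial.C b * Polynomial.X ^ d) else 0 := by
  split_ifs with h
  · obtain ⟨s, rfl⟩ := Nat.exists_eq_add_of_le h
    rw [Nat.add_sub_cancel_left, add_comm, slice_mul_C_mul_X_pow]
  · unfold slice
    rw [← mul_assoc, Polynomial.coeff_mul_X_pow', if_neg h, map_zero, zero_mul]

/-- Over any commutative ring: if `y` is linearly independent on `s` but not on `insert j s`,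
some non-zero multiple of `y j` lies in the span of `y '' s`. [folklore] -/
theorem exists_smul_mem_span_of_dep {A M : Type*} [CommRing A] [AddCommGroup M] [Module A M]
    {ι : Type*} {y : ι → M} {s : Set ι} {j : ι} (hs : LinearIndepOn A y s)
    (hjs : ¬ LinearIndepOn A y (insert j s)) :
    ∃ a : A, a ≠ 0 ∧ a • y j ∈ Submodule.span A (y '' s) := by
  classical
  rw [linearIndepOn_iff] at hjs
  push Not at hjs
  obtain ⟨l, hl, hl0, hlne⟩ := hjs
  have hlj : l j ≠ 0 := by
    intro h
    apply hlne
    refine (linearIndepOn_iff.mp hs) l ?_ hl0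
    intro i hi
    have hi' := hl hi
    rcases Set.mem_insert_iff.mp hi' with rfl | h'
    · exact absurd h (Finsupp.mem_support_iff.mp hi)
    · exact h'
  refine ⟨l j, hlj, ?_⟩
  have hsplit : Finsupp.linearCombination A y l =
      Finsupp.linearCombination A y (l.erase j) + l j • y j := by
    conv_lhs => rw [← Finsupp.erase_add_single j l]
    rw [map_add, Finsupp.linearCombination_single]
  have herase : Finsupp.linearCombination A y (l.erase j) ∈ Submodule.span A (y '' s) := by
    rw [Finsupp.mem_span_image_iff_linearCombination]
    refine ⟨l.erase j, ?_, rfl⟩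
    intro i hi
    rw [Finset.mem_coe, Finsupp.support_erase, Finset.mem_erase] at hi
    rcases Set.mem_insert_iff.mp (hl hi.2) with h | h
    · exact absurd h hi.1
    · exact h
  have e : l j • y j = -Finsupp.linearCombination A y (l.erase j) := by
    rw [hl0] at hsplit
    exact (neg_eq_of_add_eq_zero_right hsplit.symm).symm
  rw [e]
  exact Submodule.neg_mem _ herase

/-- **Core data for the sandwich.** For a finite-dimensional `K`-subspace `W` of a domain `R` (over an infinite
field `K`), linear Noether normalisation of `K[Wτ]` yields `u₁, …, u_r ∈ W` with `uᵢτ`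
algebraically independent and `K[Wτ]` finite over `P = K[uτ]`; a maximal `P`-free family of
homogeneous module generators `b₁, …, b_ρ` (degrees `dᵢ`) and a homogeneous common denominator
of degree `γ` then give, coefficientwise in degree `t`,
`∑ᵢ dim P_{t-dᵢ} ≤ dim W^t ≤ ∑ᵢ dim P_{t+γ-dᵢ}` with `dim P_e = binom(e+r-1, e)`.
[folklore; cf. Atiyah–Macdonald Ch. 11, Eisenbud Ch. 12 (Hilbert polynomial of a finite graded
module over a polynomial ring)] [folklore] -/
theorem exists_core [Infinite K] [IsDomain R] (W : Submodule K R) [FiniteDimensional K W] :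
    ∃ (r : ℕ) (u : Fin r → R), (∀ i, u i ∈ W) ∧ AlgebraicIndependent K (fun i => cX (u i)) ∧
      (∀ x ∈ W, IsIntegral (Algebra.adjoin K (Set.range fun i => cX (u i))) (cX x)) ∧
      ∃ (ρ : ℕ) (b : Fin ρ → R[X]) (d : Fin ρ → ℕ) (β : Fin ρ → R) (κ : R) (γ : ℕ),
        1 ≤ ρ ∧ (∀ i, b i = Polynomial.C (β i) * Polynomial.X ^ (d i)) ∧ (∀ i, β i ∈ W ^ (d i)) ∧
        LinearIndependent (Algebra.adjoin K (Set.range fun i => cX (u i))) b ∧ κ ≠ 0 ∧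
        Polynomial.C κ * Polynomial.X ^ γ ∈ Algebra.adjoin K (Set.range fun i => cX (u i)) ∧
        ∀ p ∈ reesAlgebra K W, Polynomial.C κ * Polynomial.X ^ γ * p ∈
          Submodule.span (Algebra.adjoin K (Set.range fun i => cX (u i))) (Set.range b) := by
  classical
  -- a spanning family of `W`
  set n : ℕ := Module.finrank K W with hn
  let bW := Module.finBasis K W
  set w : Fin n → R := fun i => (bW i : R) with hw
  have hwW : ∀ i, w i ∈ W := fun i => (bW i).2
  have hspan : Submodule.span K (Set.range w) = W := by
    apply le_antisymm
    · exact Submodule.span_le.mpr (by rintro _ ⟨i, rfl⟩; exact hwW i)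
    · intro x hx
      have hx' : (⟨x, hx⟩ : W) ∈ Submodule.span K (Set.range bW) := by
        rw [bW.span_eq]; exact Submodule.mem_top
      have h := Submodule.apply_mem_span_image_of_mem_span W.subtype hx'
      rwa [← Set.range_comp] at h
  -- linear Noether normalisation
  obtain ⟨r, u, hu, hind, hint⟩ := linear_noether (K := K) n w
  have huW : ∀ i, u i ∈ W := fun i => by rw [← hspan]; exact hu i
  set A : Subalgebra K R[X] := Algebra.adjoin K (Set.range fun i => cX (u i)) with hA_def
  set T : Subalgebra K R[X] := reesAlgebra K W with hT_def
  have hTw : Algebra.adjoin K (Set.range fun i => cX (w i)) = T := by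
    rw [adjoin_range_cX_eq, hspan]
  have hAT : A ≤ T :=
    Algebra.adjoin_le (by rintro _ ⟨i, rfl⟩; exact Algebra.subset_adjoin ⟨u i, huW i, rfl⟩)
  have hTint : ∀ p ∈ T, IsIntegral A p := by
    intro p hp
    have hle : T ≤ (integralClosure A R[X]).restrictScalars K := by
      rw [← hTw]; exact Algebra.adjoin_le (by rintro _ ⟨j, rfl⟩; exact hint j)
    exact hle hp
  refine ⟨r, u, huW, hind, fun x hx => hTint _ (Algebra.subset_adjoin ⟨x, hx, rfl⟩), ?_⟩
  -- `T` is a finite `A`-module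
  have hMfg : (Subalgebra.toSubmodule (Algebra.adjoin A (Set.range fun j => cX (w j)))).FG :=
    fg_adjoin_of_finite (Set.finite_range _) (by rintro _ ⟨j, rfl⟩; exact hint j)
  have hTM : ∀ p ∈ T, p ∈ Subalgebra.toSubmodule (Algebra.adjoin A (Set.range fun j => cX (w j))) := by
    intro p hp
    rw [← hTw] at hp
    have hle : Algebra.adjoin K (Set.range fun j => cX (w j)) ≤
        (Algebra.adjoin A (Set.range fun j => cX (w j))).restrictScalars K :=
      Algebra.adjoin_le Algebra.subset_adjoin
    exact hle hp
  have hMT : ∀ p ∈ Algebra.adjoin A (Set.range fun j => cX (w j)), p ∈ T := by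
    intro p hp
    induction hp using Algebra.adjoin_induction with
    | mem x hx => obtain ⟨j, rfl⟩ := hx; rw [← hTw]; exact Algebra.subset_adjoin ⟨j, rfl⟩
    | algebraMap a => exact hAT a.2
    | add x y _ _ hx hy => exact T.add_mem hx hy
    | mul x y _ _ hx hy => exact T.mul_mem hx hy
  obtain ⟨G, hG⟩ := hMfg
  -- homogeneous module generators: the slices of the elements of `G`
  set D : ℕ := G.sup Polynomial.natDegree + 1 with hD
  set y : ↥G × Fin D → R[X] := fun j => slice j.2 (j.1 : R[X]) with hy_def
  have hGT : ∀ q ∈ G, q ∈ T := fun q hq =>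
    hMT q (by
      have h := Submodule.subset_span (R := A) (s := (↑G : Set R[X])) hq
      rw [hG] at h
      exact h)
  have hyT : ∀ j, y j ∈ T := fun j => slice_mem_reesAlgebra (hGT j.1 j.1.2) _
  have hy_span : ∀ p ∈ T, p ∈ Submodule.span A (Set.range y) := by
    intro p hp
    have hpM := hTM p hp
    rw [← hG, Submodule.mem_span_finset] at hpM
    obtain ⟨f, -, hf⟩ := hpM
    rw [← hf]
    refine Submodule.sum_mem _ fun q hq => ?_
    have hqD : q.natDegree < D := by
      have h : q.natDegree ≤ G.sup Polynomial.natDegree := Finset.le_sup hq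
      omega
    rw [← sum_slice_eq q hqD, Finset.smul_sum]
    refine Submodule.sum_mem _ fun t ht => ?_
    rw [Finset.mem_range] at ht
    exact Submodule.smul_mem _ _ (Submodule.subset_span ⟨(⟨q, hq⟩, ⟨t, ht⟩), rfl⟩)
  -- each `y j` is a monomial `C β τ^d` with `β ∈ W^d`
  have hy_form : ∀ j : ↥G × Fin D,
      y j = Polynomial.C ((j.1 : R[X]).coeff j.2) * Polynomial.X ^ (j.2 : ℕ) :=
    fun j => rfl
  have hy_coeff : ∀ j : ↥G × Fin D, (j.1 : R[X]).coeff j.2 ∈ W ^ (j.2 : ℕ) := fun j =>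
    (mem_reesAlgebra_iff.mp (hGT j.1 j.1.2)) _
  -- `A` is graded: slices of its elements are values of homogeneous polynomials at `uτ`
  have hAsl : ∀ a ∈ A, ∀ t, ∃ g ∈ homogeneousSubmodule (Fin r) K t,
      slice t a = aeval (fun i => cX (u i)) g := by
    intro a ha t
    rw [hA_def, Algebra.adjoin_range_eq_range_aeval, AlgHom.mem_range] at ha
    obtain ⟨g, rfl⟩ := ha
    exact ⟨homogeneousComponent t g, homogeneousComponent_mem t g, slice_aeval_cX u g t⟩
  have hAsl' : ∀ a ∈ A, ∀ t, slice t a ∈ A := by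
    intro a ha t
    obtain ⟨g, -, hg⟩ := hAsl a ha t
    rw [hg, hA_def, Algebra.adjoin_range_eq_range_aeval]
    exact ⟨g, rfl⟩
  -- a maximal `A`-linearly independent subfamily of `y`
  set indep : Finset (↥G × Fin D) → Prop := fun s => LinearIndepOn A y (↑s : Set (↥G × Fin D))
    with hindep
  obtain ⟨s, hs, hsmax⟩ := Finset.exists_max_image (Finset.univ.filter indep) Finset.card
    ⟨∅, by simp [indep]⟩
  simp only [Finset.mem_filter, Finset.mem_univ, true_and, indep] at hs hsmax
  have hdep : ∀ j, ∃ a : A, a ≠ 0 ∧ a • y j ∈ Submodule.span A (y '' ↑s) := by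
    intro j
    by_cases hj : j ∈ s
    · exact ⟨1, one_ne_zero, by rw [one_smul]; exact Submodule.subset_span ⟨j, hj, rfl⟩⟩
    · refine exists_smul_mem_span_of_dep hs fun hins => ?_
      have hcard := hsmax (insert j s) (by rwa [Finset.coe_insert])
      rw [Finset.card_insert_of_notMem hj] at hcard
      omega
  -- the independent family is non-empty
  have hy0 : ∃ j, y j ≠ 0 := by
    by_contra! h0
    have h1T : (1 : R[X]) ∈ Submodule.span A (Set.range y) := hy_span 1 T.one_mem
    have hbot : Submodule.span A (Set.range y) = ⊥ := by
      rw [Submodule.span_eq_bot]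
      rintro _ ⟨j, rfl⟩
      exact h0 j
    rw [hbot, Submodule.mem_bot] at h1T
    exact one_ne_zero h1T
  have hρ : 1 ≤ s.card := by
    obtain ⟨j, hj⟩ := hy0
    by_contra hlt
    have hs0 : s = ∅ := Finset.card_eq_zero.mp (by omega)
    have hind1 : LinearIndepOn A y (↑({j} : Finset (↥G × Fin D)) : Set (↥G × Fin D)) := by
      rw [Finset.coe_singleton, linearIndepOn_singleton_iff]
      exact hj
    have h := hsmax {j} hind1
    rw [hs0] at h
    simp at h
  -- reindex the independent family by `Fin ρ`
  set ρ : ℕ := s.card with hρ_def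
  let e : Fin ρ ≃ ↥s := s.equivFin.symm
  set b : Fin ρ → R[X] := fun i => y ((e i : ↥s) : ↥G × Fin D) with hb_def
  have hbind : LinearIndependent A b := by
    have h := hs.linearIndependent
    exact h.comp (fun i => ⟨((e i : ↥s) : ↥G × Fin D), (e i).2⟩) (fun i i' hii' => by
      apply e.injective
      exact Subtype.ext (congrArg Subtype.val hii'))
  have hrange_b : Set.range b = y '' ↑s := by
    ext p
    constructor
    · rintro ⟨i, rfl⟩
      exact ⟨_, (e i).2, rfl⟩
    · rintro ⟨j, hj, rfl⟩
      refine ⟨e.symm ⟨j, hj⟩, ?_⟩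
      simp [b]
  set d : Fin ρ → ℕ := fun i => ((((e i : ↥s) : ↥G × Fin D)).2 : ℕ) with hd_def
  set β : Fin ρ → R := fun i => ((((e i : ↥s) : ↥G × Fin D)).1 : R[X]).coeff (d i) with hβ_def
  have hb_form : ∀ i, b i = Polynomial.C (β i) * Polynomial.X ^ (d i) := fun i => rfl
  have hβW : ∀ i, β i ∈ W ^ (d i) := fun i => hy_coeff _
  have hbT : ∀ i, b i ∈ T := fun i => hyT _
  set F : Submodule A R[X] := Submodule.span A (Set.range b) with hF_def
  have hFs : Submodule.span A (y '' ↑s) = F := by rw [hF_def, hrange_b]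
  -- `F` is graded
  have hFsl : ∀ p ∈ F, ∀ t, slice t p ∈ F := by
    intro p hp t
    rw [hF_def, Submodule.mem_span_range_iff_exists_fun] at hp
    obtain ⟨cf, rfl⟩ := hp
    rw [slice_sum]
    refine Submodule.sum_mem _ fun i _ => ?_
    rw [Subalgebra.smul_def, smul_eq_mul, hb_form i, slice_mul_C_mul_X_pow']
    split_ifs with hle
    · rw [← hb_form]
      have hmem : slice (t - d i) (cf i : R[X]) ∈ A := hAsl' _ (cf i).2 _
      have e1 : slice (t - d i) (cf i : R[X]) * b i = (⟨_, hmem⟩ : A) • b i := rfl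
      rw [e1]
      exact Submodule.smul_mem _ _ (Submodule.subset_span ⟨i, rfl⟩)
    · exact Submodule.zero_mem _
  -- homogeneous non-zero multipliers pushing each `y j` into `F`
  have hmult : ∀ j, ∃ α : R, ∃ t₀ : ℕ, α ≠ 0 ∧
      Polynomial.C α * Polynomial.X ^ t₀ ∈ A ∧ Polynomial.C α * Polynomial.X ^ t₀ * y j ∈ F := by
    intro j
    obtain ⟨a, ha0, haj⟩ := hdep j
    rw [hFs] at haj
    have ha0' : (a : R[X]) ≠ 0 := fun h => ha0 (Subtype.ext h)
    obtain ⟨t₀, ht₀⟩ : ∃ t₀, (a : R[X]).coeff t₀ ≠ 0 := by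
      by_contra! h
      exact ha0' (Polynomial.ext fun t => by rw [h t, Polynomial.coeff_zero])
    refine ⟨(a : R[X]).coeff t₀, t₀, ht₀, hAsl' _ a.2 t₀, ?_⟩
    have h := hFsl _ haj (t₀ + j.2)
    rw [Subalgebra.smul_def, smul_eq_mul, hy_form j, slice_mul_C_mul_X_pow] at h
    rw [hy_form j]
    exact h
  choose α t₀ hα0 hαA hαF using hmult
  set κ : R := ∏ j, α j with hκ_def
  set γ : ℕ := ∑ j, t₀ j with hγ_def
  have hκ0 : κ ≠ 0 := Finset.prod_ne_zero_iff.mpr fun j _ => hα0 j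
  have hc_eq : ∏ j, Polynomial.C (α j) * Polynomial.X ^ t₀ j =
      Polynomial.C κ * Polynomial.X ^ γ := by
    rw [Finset.prod_mul_distrib, ← map_prod, Finset.prod_pow_eq_pow_sum]
  have hcA : Polynomial.C κ * Polynomial.X ^ γ ∈ A := by
    rw [← hc_eq]
    exact Subalgebra.prod_mem _ fun j _ => hαA j
  have hcy : ∀ j, Polynomial.C κ * Polynomial.X ^ γ * y j ∈ F := by
    intro j
    rw [← hc_eq, ← Finset.prod_erase_mul _ _ (Finset.mem_univ j), mul_assoc]
    have hmem : ∏ j' ∈ Finset.univ.erase j, Polynomial.C (α j') * Polynomial.X ^ t₀ j' ∈ A :=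
      Subalgebra.prod_mem _ fun j' _ => hαA j'
    have e1 : (∏ j' ∈ Finset.univ.erase j, Polynomial.C (α j') * Polynomial.X ^ t₀ j') *
        (Polynomial.C (α j) * Polynomial.X ^ t₀ j * y j) =
        (⟨_, hmem⟩ : A) • (Polynomial.C (α j) * Polynomial.X ^ t₀ j * y j) := rfl
    rw [e1]
    exact Submodule.smul_mem _ _ (hαF j)
  have hcT : ∀ p ∈ T, Polynomial.C κ * Polynomial.X ^ γ * p ∈ F := by
    intro p hp
    have h := hy_span p hp
    rw [Submodule.mem_span_range_iff_exists_fun] at h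
    obtain ⟨cf, rfl⟩ := h
    rw [Finset.mul_sum]
    refine Submodule.sum_mem _ fun j _ => ?_
    rw [mul_smul_comm]
    exact Submodule.smul_mem _ _ (hcy j)
  exact ⟨ρ, b, d, β, κ, γ, hρ, hb_form, hβW, hbind, hκ0, hcA, hcT⟩


/-! ### Counting: the two-sided binomial bound -/

section Counting

variable {r ρ : ℕ} {u : Fin r → R} {W : Submodule K R}
  {b : Fin ρ → R[X]} {d : Fin ρ → ℕ} {β : Fin ρ → R}

/-- Forms of a fixed degree in finitely many variables are a finite-dimensional space. [folklore] -/
instance finite_homogeneousSubmodule_fin (r n : ℕ) :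
    Module.Finite K ↥(homogeneousSubmodule (Fin r) K n) :=
  Module.Finite.iff_fg.mpr (homogeneousSubmodule_fg (Fin r) K n)

omit [Algebra K R] in
/-- Product of two monomials. [folklore] -/
theorem C_mul_X_pow_mul_C_mul_X_pow (a a' : R) (m m' : ℕ) :
    Polynomial.C a * Polynomial.X ^ m * (Polynomial.C a' * Polynomial.X ^ m') =
      Polynomial.C (a * a') * Polynomial.X ^ (m + m') := by
  rw [map_mul, pow_add]; ring

/-- The counting map `Φ_t : (gᵢ)ᵢ ↦ ∑ᵢ gᵢ(uτ) · bᵢ` on tuples of forms of degrees `t - dᵢ`. [folklore] -/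
def countMap (u : Fin r → R) (b : Fin ρ → R[X]) (d : Fin ρ → ℕ) (t : ℕ) :
    ((i : Fin ρ) → ↥(homogeneousSubmodule (Fin r) K (t - d i))) →ₗ[K] R[X] :=
  ∑ i, (LinearMap.mulRight K (b i)) ∘ₗ (aeval fun i => cX (u i)).toLinearMap ∘ₗ
    (homogeneousSubmodule (Fin r) K (t - d i)).subtype ∘ₗ LinearMap.proj i

/-- Unfolding the counting map. [folklore] -/
theorem countMap_apply (t : ℕ) (g : (i : Fin ρ) → ↥(homogeneousSubmodule (Fin r) K (t - d i))) :
    countMap (K := K) u b d t g = ∑ i, aeval (fun i => cX (u i)) (g i : MvPolynomial (Fin r) K) * b i := by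
  simp only [countMap, LinearMap.coe_sum, Finset.sum_apply, LinearMap.comp_apply,
    LinearMap.proj_apply, Submodule.subtype_apply, LinearMap.mulRight_apply, AlgHom.toLinearMap_apply]

/-- Values of polynomials at `uτ` lie in `K[uτ]`. [folklore] -/
theorem aeval_mem_adjoin (g : MvPolynomial (Fin r) K) :
    aeval (fun i => cX (u i)) g ∈ Algebra.adjoin K (Set.range fun i => cX (u i)) := by
  rw [Algebra.adjoin_range_eq_range_aeval]; exact ⟨g, rfl⟩

/-- With `bᵢ = C βᵢ τ^{dᵢ}` and `dᵢ ≤ t`, `Φ_t g` is the monomial `C(∑ᵢ gᵢ(u) βᵢ) τ^t`. [folklore] -/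
theorem countMap_eq (hb : ∀ i, b i = Polynomial.C (β i) * Polynomial.X ^ (d i)) {t : ℕ}
    (ht : ∀ i, d i ≤ t) (g : (i : Fin ρ) → ↥(homogeneousSubmodule (Fin r) K (t - d i))) :
    countMap (K := K) u b d t g =
      Polynomial.C (∑ i, aeval u (g i : MvPolynomial (Fin r) K) * β i) * Polynomial.X ^ t := by
  rw [countMap_apply, map_sum, Finset.sum_mul]
  refine Finset.sum_congr rfl fun i _ => ?_
  have hhom : ((g i : MvPolynomial (Fin r) K)).IsHomogeneous (t - d i) :=
    (mem_homogeneousSubmodule _ _).mp (g i).2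
  rw [aeval_cX hhom u, hb i, C_mul_X_pow_mul_C_mul_X_pow, Nat.sub_add_cancel (ht i)]

/-- `Φ_t` is injective when `uτ` is algebraically independent and `b` is `K[uτ]`-free. [folklore] -/
theorem countMap_injective [IsDomain R] (hind : AlgebraicIndependent K (fun i => cX (u i)))
    (hbind : LinearIndependent (Algebra.adjoin K (Set.range fun i => cX (u i))) b) (t : ℕ) :
    Function.Injective (countMap (K := K) u b d t) := by
  rw [injective_iff_map_eq_zero]
  intro g hg
  rw [countMap_apply] at hg
  have h := (Fintype.linearIndependent_iff.mp hbind)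
    (fun i => (⟨aeval (fun i => cX (u i)) (g i : MvPolynomial (Fin r) K), aeval_mem_adjoin _⟩ :
      Algebra.adjoin K (Set.range fun i => cX (u i)))) (by
    simpa only [Subalgebra.smul_def, smul_eq_mul] using hg)
  funext i
  have hi : aeval (fun i => cX (u i)) (g i : MvPolynomial (Fin r) K) = 0 := congrArg Subtype.val (h i)
  have hi' : (g i : MvPolynomial (Fin r) K) = 0 := hind (by rw [map_zero]; exact hi)
  exact Subtype.ext hi'

/-- Homogeneous elements of degree `t` of the span `F = ∑ K[uτ] bᵢ` are values of `Φ_t`. [folklore] -/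
theorem slice_mem_range_countMap (hb : ∀ i, b i = Polynomial.C (β i) * Polynomial.X ^ (d i))
    {t : ℕ} (ht : ∀ i, d i ≤ t) {p : R[X]}
    (hp : p ∈ Submodule.span (Algebra.adjoin K (Set.range fun i => cX (u i))) (Set.range b)) :
    slice t p ∈ LinearMap.range (countMap (K := K) u b d t) := by
  rw [Submodule.mem_span_range_iff_exists_fun] at hp
  obtain ⟨cf, rfl⟩ := hp
  have hg : ∀ i, ∃ g ∈ homogeneousSubmodule (Fin r) K (t - d i),
      slice (t - d i) (cf i : R[X]) = aeval (fun i => cX (u i)) g := by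
    intro i
    have ha : (cf i : R[X]) ∈ (aeval fun i => cX (u i) : MvPolynomial (Fin r) K →ₐ[K] R[X]).range := by
      rw [← Algebra.adjoin_range_eq_range_aeval]; exact (cf i).2
    rw [AlgHom.mem_range] at ha
    obtain ⟨g, hg⟩ := ha
    exact ⟨homogeneousComponent (t - d i) g, homogeneousComponent_mem _ g, by
      rw [← hg]; exact slice_aeval_cX u g _⟩
  choose g hgmem hgeq using hg
  refine ⟨fun i => ⟨g i, hgmem i⟩, ?_⟩
  rw [countMap_apply, slice_sum]
  refine Finset.sum_congr rfl fun i _ => ?_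
  rw [Subalgebra.smul_def, smul_eq_mul, hb i, slice_mul_C_mul_X_pow', if_pos (ht i), ← hb, hgeq]

/-- The source of `Φ_t` has dimension `∑ᵢ binom(t - dᵢ + r - 1, t - dᵢ)`. [folklore] -/
theorem finrank_source_countMap (t : ℕ) :
    Module.finrank K ((i : Fin ρ) → ↥(homogeneousSubmodule (Fin r) K (t - d i))) =
      ∑ i, (t - d i + r - 1).choose (t - d i) := by
  rw [Module.finrank_pi_fintype]
  exact Finset.sum_congr rfl fun i _ => finrank_homogeneousSubmodule_fin K r _

/-- **Lower bound**: `∑ᵢ binom(t - dᵢ + r - 1, t - dᵢ) ≤ dim W^t` for `t ≥ max dᵢ`. [folklore] -/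
theorem sum_choose_le_finrank_pow [IsDomain R] [FiniteDimensional K W]
    (hind : AlgebraicIndependent K (fun i => cX (u i))) (huW : ∀ i, u i ∈ W)
    (hb : ∀ i, b i = Polynomial.C (β i) * Polynomial.X ^ (d i)) (hβ : ∀ i, β i ∈ W ^ (d i))
    (hbind : LinearIndependent (Algebra.adjoin K (Set.range fun i => cX (u i))) b)
    {t : ℕ} (ht : ∀ i, d i ≤ t) :
    ∑ i, (t - d i + r - 1).choose (t - d i) ≤ Module.finrank K ↥(W ^ t) := by
  haveI : Module.Finite K ↥(W ^ t) :=
    Module.Finite.iff_fg.mpr ((Module.Finite.iff_fg.mp inferInstance).pow t)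
  -- `Φ_t g ∈ K[Wτ]`
  have hAT : Algebra.adjoin K (Set.range fun i => cX (u i)) ≤ reesAlgebra K W :=
    Algebra.adjoin_le (by rintro _ ⟨i, rfl⟩; exact Algebra.subset_adjoin ⟨u i, huW i, rfl⟩)
  have hbT : ∀ i, b i ∈ reesAlgebra K W := by
    intro i
    rw [mem_reesAlgebra_iff, hb i]
    intro s
    rw [Polynomial.coeff_C_mul_X_pow]
    split_ifs with h
    · subst h; exact hβ i
    · exact Submodule.zero_mem _
  have hΦT : ∀ g, countMap (K := K) u b d t g ∈ reesAlgebra K W := fun g => by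
    rw [countMap_apply]
    exact Subalgebra.sum_mem _ fun i _ => Subalgebra.mul_mem _ (hAT (aeval_mem_adjoin _)) (hbT i)
  let Λ : ((i : Fin ρ) → ↥(homogeneousSubmodule (Fin r) K (t - d i))) →ₗ[K] R :=
    ((Polynomial.lcoeff R t).restrictScalars K) ∘ₗ countMap (K := K) u b d t
  have hΛ : ∀ g, Λ g = (countMap (K := K) u b d t g).coeff t := fun g => rfl
  have hΛW : ∀ g, Λ g ∈ W ^ t := fun g => by
    rw [hΛ]; exact (mem_reesAlgebra_iff.mp (hΦT g)) t
  have hΛ' : ∀ g, countMap (K := K) u b d t g = Polynomial.C (Λ g) * Polynomial.X ^ t := fun g => by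
    rw [hΛ, countMap_eq hb ht g, Polynomial.coeff_C_mul_X_pow, if_pos rfl]
  have hΛinj : Function.Injective (LinearMap.codRestrict (W ^ t) Λ hΛW) := by
    intro g g' hgg'
    have h1 : Λ g = Λ g' := congrArg Subtype.val hgg'
    apply countMap_injective hind hbind t
    rw [hΛ' g, hΛ' g', h1]
  have h := LinearMap.finrank_le_finrank_of_injective hΛinj
  rwa [finrank_source_countMap] at h

/-- **Upper bound**: `dim W^t ≤ ∑ᵢ binom(t + γ - dᵢ + r - 1, t + γ - dᵢ)` for `t ≥ max dᵢ`, given a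
homogeneous common denominator `C κ τ^γ` pushing `K[Wτ]` into `∑ K[uτ] bᵢ`. [folklore] -/
theorem finrank_pow_le_sum_choose [IsDomain R] [FiniteDimensional K W]
    (hb : ∀ i, b i = Polynomial.C (β i) * Polynomial.X ^ (d i)) {κ : R} {γ : ℕ} (hκ : κ ≠ 0)
    (hc : ∀ p ∈ reesAlgebra K W, Polynomial.C κ * Polynomial.X ^ γ * p ∈
      Submodule.span (Algebra.adjoin K (Set.range fun i => cX (u i))) (Set.range b))
    {t : ℕ} (ht : ∀ i, d i ≤ t) :
    Module.finrank K ↥(W ^ t) ≤ ∑ i, (t + γ - d i + r - 1).choose (t + γ - d i) := by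
  have htγ : ∀ i, d i ≤ t + γ := fun i => (ht i).trans (Nat.le_add_right _ _)
  let Θ : ↥(W ^ t) →ₗ[K] R[X] :=
    (LinearMap.mulLeft K (Polynomial.C κ * Polynomial.X ^ γ)) ∘ₗ
      ((Polynomial.monomial t).restrictScalars K) ∘ₗ (W ^ t).subtype
  have hΘ : ∀ x : ↥(W ^ t), Θ x =
      Polynomial.C κ * Polynomial.X ^ γ * (Polynomial.C (x : R) * Polynomial.X ^ t) := by
    intro x
    simp only [Θ, LinearMap.comp_apply, LinearMap.mulLeft_apply, LinearMap.restrictScalars_apply,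
      Submodule.subtype_apply, Polynomial.C_mul_X_pow_eq_monomial]
  have hΘrange : ∀ x : ↥(W ^ t), Θ x ∈ LinearMap.range (countMap (K := K) u b d (t + γ)) := by
    intro x
    have hxT : Polynomial.C (x : R) * Polynomial.X ^ t ∈ reesAlgebra K W := by
      rw [mem_reesAlgebra_iff]
      intro s'
      rw [Polynomial.coeff_C_mul_X_pow]
      split_ifs with h
      · subst h; exact x.2
      · exact Submodule.zero_mem _
    have hF' := hc _ hxT
    have hsl : slice (t + γ) (Θ x) = Θ x := by
      rw [hΘ]
      rw [C_mul_X_pow_mul_C_mul_X_pow, add_comm γ t, slice_C_mul_X_pow, if_pos rfl]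
    rw [← hsl]
    refine slice_mem_range_countMap hb htγ ?_
    rw [hΘ]; exact hF'
  have hΘinj : Function.Injective
      (LinearMap.codRestrict (LinearMap.range (countMap (K := K) u b d (t + γ))) Θ hΘrange) := by
    intro x x' hxx'
    have h1 : Θ x = Θ x' := congrArg Subtype.val hxx'
    rw [hΘ, hΘ] at h1
    have hc0 : Polynomial.C κ * Polynomial.X ^ γ ≠ 0 :=
      mul_ne_zero ((map_ne_zero_iff _ Polynomial.C_injective).mpr hκ)
        (pow_ne_zero _ Polynomial.X_ne_zero)
    have h2 := mul_left_cancel₀ hc0 h1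
    have h3 : (x : R) = x' := by
      have := congrArg (fun q : R[X] => q.coeff t) h2
      simpa [Polynomial.coeff_C_mul_X_pow] using this
    exact Subtype.ext h3
  have h := LinearMap.finrank_le_finrank_of_injective hΘinj
  exact h.trans ((LinearMap.finrank_range_le _).trans (finrank_source_countMap (K := K) (t + γ)).le)

end Counting

/-- **The sandwich (raw form).** For a finite-dimensional `K`-subspace `W` of a domain `R` over an
infinite field `K`: there are `r`, `u : Fin r → W` with `uᵢτ` algebraically independent and all
`wτ` (`w ∈ W`) integral over `K[uτ]`, and `ρ ≥ 1` degrees `dᵢ` and `γ` with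
`∑ᵢ binom(t - dᵢ + r - 1, t - dᵢ) ≤ dim_K W^t ≤ ∑ᵢ binom(t + γ - dᵢ + r - 1, t + γ - dᵢ)` for all
`t ≥ max dᵢ`. [folklore; Hilbert function of the Rees-type algebra `K[Wτ]`, cf.
Atiyah–Macdonald Ch. 11] [folklore] -/
theorem exists_sandwich [Infinite K] [IsDomain R] (W : Submodule K R) [FiniteDimensional K W] :
    ∃ (r : ℕ) (u : Fin r → R), (∀ i, u i ∈ W) ∧ AlgebraicIndependent K (fun i => cX (u i)) ∧
      (∀ x ∈ W, IsIntegral (Algebra.adjoin K (Set.range fun i => cX (u i))) (cX x)) ∧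
      ∃ (ρ : ℕ) (d : Fin ρ → ℕ) (γ : ℕ), 1 ≤ ρ ∧ ∀ t, (∀ i, d i ≤ t) →
        (∑ i, (t - d i + r - 1).choose (t - d i)) ≤ Module.finrank K ↥(W ^ t) ∧
        Module.finrank K ↥(W ^ t) ≤ ∑ i, (t + γ - d i + r - 1).choose (t + γ - d i) := by
  obtain ⟨r, u, huW, hind, hint, ρ, b, d, β, κ, γ, hρ, hb, hβ, hbind, hκ, -, hc⟩ := exists_core W
  exact ⟨r, u, huW, hind, hint, ρ, d, γ, hρ, fun t ht =>
    ⟨sum_choose_le_finrank_pow hind huW hb hβ hbind ht, finrank_pow_le_sum_choose hb hκ hc ht⟩⟩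

/-! ### The number of algebraically independent `uᵢτ` is `dim R + 1` -/

/-- Every element of `R = K[W]` (with `1 ∈ W`) lies in some power `W^k`. [folklore] -/
theorem exists_mem_pow {W : Submodule K R} (h1 : (1 : R) ∈ W)
    (hgen : Algebra.adjoin K (W : Set R) = ⊤) (x : R) : ∃ k, x ∈ W ^ k := by
  have hx : x ∈ Algebra.adjoin K (W : Set R) := by rw [hgen]; exact Algebra.mem_top
  induction hx using Algebra.adjoin_induction with
  | mem x hx => exact ⟨1, by simpa using hx⟩
  | algebraMap k => exact ⟨0, by rw [pow_zero]; exact Submodule.mem_one.mpr ⟨k, rfl⟩⟩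
  | add x y _ _ hx hy =>
    obtain ⟨a, ha⟩ := hx
    obtain ⟨b, hb⟩ := hy
    refine ⟨a + b, Submodule.add_mem _ ?_ ?_⟩
    · have e : x = x * 1 ^ b := by simp
      rw [e, pow_add]
      exact Submodule.mul_mem_mul ha (Submodule.pow_mem_pow W h1 b)
    · have e : y = 1 ^ a * y := by simp
      rw [e, pow_add]
      exact Submodule.mul_mem_mul (Submodule.pow_mem_pow W h1 a) hb
  | mul x y _ _ hx hy =>
    obtain ⟨a, ha⟩ := hx
    obtain ⟨b, hb⟩ := hy
    exact ⟨a + b, by rw [pow_add]; exact Submodule.mul_mem_mul ha hb⟩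

/-- Powers increase when `1 ∈ W`: `W^k ≤ W^(k + j)`. [folklore] -/
theorem pow_le_pow_add {W : Submodule K R} (h1 : (1 : R) ∈ W) (k j : ℕ) : W ^ k ≤ W ^ (k + j) := by
  intro x hx
  have e : x = x * 1 ^ j := by simp
  rw [e, pow_add]
  exact Submodule.mul_mem_mul hx (Submodule.pow_mem_pow W h1 j)

/-- **Dimension count.** If `1 ∈ W`, `K[W] = R` is an affine domain, `u₁τ, …, u_rτ` are
algebraically independent with `uᵢ ∈ W`, and all `wτ` (`w ∈ W`) are integral over `K[uτ]`, then
`uτ` is a transcendence basis of `R[τ]` over `K`, so `r = dim R[τ] = dim R + 1`. [folklore] -/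
theorem ringKrullDim_add_one_eq [IsDomain R] [Algebra.FiniteType K R] {W : Submodule K R}
    (h1 : (1 : R) ∈ W) (hgen : Algebra.adjoin K (W : Set R) = ⊤) {r : ℕ} {u : Fin r → R}
    (huW : ∀ i, u i ∈ W) (hind : AlgebraicIndependent K (fun i => cX (u i)))
    (hint : ∀ x ∈ W, IsIntegral (Algebra.adjoin K (Set.range fun i => cX (u i))) (cX x)) :
    ringKrullDim R + 1 = r := by
  classical
  set A : Subalgebra K R[X] := Algebra.adjoin K (Set.range fun i => cX (u i)) with hA_def
  set T : Subalgebra K R[X] := reesAlgebra K W with hT_def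
  have hAT : A ≤ T :=
    Algebra.adjoin_le (by rintro _ ⟨i, rfl⟩; exact Algebra.subset_adjoin ⟨u i, huW i, rfl⟩)
  have hTint : ∀ p ∈ T, IsIntegral A p := by
    intro p hp
    have hle : T ≤ (integralClosure A R[X]).restrictScalars K :=
      Algebra.adjoin_le (by rintro _ ⟨x, hx, rfl⟩; exact hint x hx)
    exact hle hp
  -- `X^N · p ∈ K[Wτ]` for `N` large
  have hXT : (Polynomial.X : R[X]) ∈ T := by
    have h : cX (1 : R) ∈ T := Algebra.subset_adjoin ⟨1, h1, rfl⟩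
    simpa [cX] using h
  have hmul : ∀ p : R[X], ∃ N, Polynomial.X ^ N * p ∈ T := by
    intro p
    have hc : ∀ j, ∃ k, p.coeff j ∈ W ^ k := fun j => exists_mem_pow h1 hgen _
    choose k hk using hc
    refine ⟨(Finset.range (p.natDegree + 1)).sup k, ?_⟩
    rw [hT_def, mem_reesAlgebra_iff]
    intro t
    rw [Polynomial.coeff_X_pow_mul']
    split_ifs with h
    · by_cases hj : t - (Finset.range (p.natDegree + 1)).sup k ≤ p.natDegree
      · set N := (Finset.range (p.natDegree + 1)).sup k with hN
        have hkN : k (t - N) ≤ N := Finset.le_sup (by rw [Finset.mem_range]; omega)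
        have hle := pow_le_pow_add (K := K) h1 (k (t - N)) (t - k (t - N))
        rw [Nat.add_sub_cancel' (by omega)] at hle
        exact hle (hk _)
      · rw [Polynomial.coeff_eq_zero_of_natDegree_lt (by omega)]
        exact Submodule.zero_mem _
    · exact Submodule.zero_mem _
  -- `R[τ]` is algebraic over `T`, which is integral over `A`
  haveI : Algebra.IsAlgebraic T R[X] := by
    refine ⟨fun p => ?_⟩
    obtain ⟨N, hN⟩ := hmul p
    have hXN : (Polynomial.X : R[X]) ^ N ∈ T := T.pow_mem hXT N
    refine ⟨Polynomial.C (⟨_, hXN⟩ : T) * Polynomial.X - Polynomial.C (⟨_, hN⟩ : T), ?_, ?_⟩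
    · intro h
      have h1' := congrArg (fun q : Polynomial T => q.coeff 1) h
      simp only [Polynomial.coeff_sub, Polynomial.coeff_C_mul_X, Polynomial.coeff_C,
        Polynomial.coeff_zero] at h1'
      have : (Polynomial.X : R[X]) ^ N = 0 := by
        have h2 := congrArg Subtype.val h1'
        simp at h2
      exact pow_ne_zero N Polynomial.X_ne_zero this
    · simp
  letI : Algebra A T := (Subalgebra.inclusion hAT).toRingHom.toAlgebra
  haveI : IsScalarTower A T R[X] := IsScalarTower.of_algebraMap_eq fun _ => rfl
  haveI : Algebra.IsIntegral A T := ⟨fun t =>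
    (isIntegral_algHom_iff (IsScalarTower.toAlgHom A T R[X]) Subtype.val_injective).mp
      (hTint t t.2)⟩
  haveI : Algebra.IsAlgebraic A R[X] := Algebra.IsIntegral.trans_isAlgebraic A T R[X]
  have htb : IsTranscendenceBasis K (fun i => cX (u i)) :=
    hind.isTranscendenceBasis_iff_isAlgebraic.2 inferInstance
  haveI : Algebra.FiniteType K R[X] := Algebra.FiniteType.trans (S := R) inferInstance inferInstance
  haveI : IsNoetherianRing R := Algebra.FiniteType.isNoetherianRing K R
  have h := Literature.RingTheory.KrullDimension.ringKrullDim_eq_card_of_isTranscendenceBasis K R[X] htb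
  rw [Polynomial.ringKrullDim_of_isNoetherianRing, Fintype.card_fin] at h
  exact h

/-- **Hilbert function of a filtered affine domain: two-sided binomial bound.** Let `R` be a
domain, finitely generated over an infinite field `K` by a finite-dimensional subspace `W ∋ 1`,
and `m = dim R`. Then there are integers `ρ ≥ 1`, `a`, `γ` with
`ρ · binom(t - a + m, m) ≤ dim_K W^t ≤ ρ · binom(t + γ + m, m)` for all `t ≥ a`; in particular
`dim_K W^t = ρ t^m / m! + O(t^{m-1})`. (The Hilbert polynomial of the standard graded algebra
`K[Wτ] = ⊕ W^t τ^t` has degree `dim K[Wτ] - 1 = dim R`.) [folklore; cf. Atiyah–Macdonald,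
*Introduction to Commutative Algebra*, Thm 11.1 & Cor. 11.2 with Ex. 5.16 (linear Noether
normalisation); Nesterenko–Philippon (eds.), LNM 1752, Ch. 11 §2.2 (85)] [folklore] -/
theorem hilbert_sandwich [Infinite K] [IsDomain R] [Algebra.FiniteType K R] (W : Submodule K R)
    [FiniteDimensional K W] (h1 : (1 : R) ∈ W) (hgen : Algebra.adjoin K (W : Set R) = ⊤)
    {m : ℕ} (hm : ringKrullDim R = m) :
    ∃ ρ a γ : ℕ, 1 ≤ ρ ∧ ∀ t, a ≤ t →
      ρ * (t - a + m).choose m ≤ Module.finrank K ↥(W ^ t) ∧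
      Module.finrank K ↥(W ^ t) ≤ ρ * (t + γ + m).choose m := by
  obtain ⟨r, u, huW, hind, hint, ρ, d, γ, hρ, hbd⟩ := exists_sandwich (K := K) W
  have hr : ringKrullDim R + 1 = r := ringKrullDim_add_one_eq h1 hgen huW hind hint
  rw [hm] at hr
  have hr' : r = m + 1 := by
    have h : ((m + 1 : ℕ) : WithBot ℕ∞) = (r : WithBot ℕ∞) := by push_cast; exact hr
    exact (Nat.cast_injective h).symm
  subst hr'
  refine ⟨ρ, Finset.univ.sup d, γ, hρ, fun t ht => ?_⟩
  have hdt : ∀ i, d i ≤ t := fun i => (Finset.le_sup (Finset.mem_univ i)).trans ht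
  obtain ⟨hlo, hhi⟩ := hbd t hdt
  have hchoose : ∀ e : ℕ, (e + (m + 1) - 1).choose e = (e + m).choose m := fun e => by
    rw [show e + (m + 1) - 1 = e + m by omega]
    exact Nat.choose_symm_add
  simp only [hchoose] at hlo hhi
  constructor
  · refine le_trans ?_ hlo
    calc ρ * (t - Finset.univ.sup d + m).choose m
        = ∑ _i : Fin ρ, (t - Finset.univ.sup d + m).choose m := by
          rw [Finset.sum_const, Finset.card_univ, Fintype.card_fin, smul_eq_mul]
      _ ≤ ∑ i, (t - d i + m).choose m := Finset.sum_le_sum fun i _ =>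
          Nat.choose_le_choose m (by
            have : d i ≤ Finset.univ.sup d := Finset.le_sup (Finset.mem_univ i)
            omega)
  · refine hhi.trans ?_
    calc ∑ i, (t + γ - d i + m).choose m
        ≤ ∑ _i : Fin ρ, (t + γ + m).choose m := Finset.sum_le_sum fun i _ =>
          Nat.choose_le_choose m (by omega)
      _ = ρ * (t + γ + m).choose m := by
          rw [Finset.sum_const, Finset.card_univ, Fintype.card_fin, smul_eq_mul]

end Literature.RingTheory.HilbertSamuel.FilteredHilbert
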